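import Literature.NumberTheory.EllipticCurves.HeegnerPointsKolyvaginPrimaryCebotarevFrobeniusProofs
import Literature.GroupTheory.FiniteAbelian.EigenKernelCharacter
import HarnessLib

/-!
# McCallum's Proposition 3.1 in kernel form, from the Čebotarev density theorem

Sibling proof file of `HeegnerPointsKolyvaginPrimaryCebotarevProofs` (McCallum 1991, Cor. 3.2 at
level `p^M`: Kolyvagin primes at which finitely many *independent* eigenclasses acquire
prescribed local *orders*). Kolyvagin's bound on the order of `Ш(E/K)[p^∞]`
(`HeegnerPointsKolyvaginPrimaryOrderTelescopeProofs`, hypothesis `hCeb`) needs the stronger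
**kernel form** of McCallum's Prop. 3.1 (PDF p. 280: *"Let `φ ∈ Hom(C, E_{p^M})` … there exist
infinitely many `l ∈ S₁(M)` such that `φ = φ_{Frob(λ)}`"*, with (3): *"`c_λ = 0` if and only if
`φ_{Frob(λ)}(c) = 0`"*): for eigenclasses `g₁ ∈ H¹(K, E_{p^M})^{ν}`, `g₂ ∈ H¹(K, E_{p^M})^{-ν}` and
a finite set `T` of eigenclasses there are Kolyvagin primes `ℓ` of level `p^M` above any bound
with **`⟨g₁, g₂, T⟩ ∩ ker(loc_λ) = ⟨T⟩`** — a prescribed *kernel*, which Cor. 3.2 (orders on an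
independent basis) cannot express when `⟨T⟩ ≤ ⟨g₁, g₂, T⟩` has no adapted basis.

* `exists_kolyvaginPrime_gt_pow_kernel` — the prime `ℓ > b` with `ℓ ∤ N d_K p`, `(ℓ)` prime in
  `𝓞 K`, `Frob(ℓ) = Frob(∞)` on `K(E_{p^M})`, and the kernel condition at the place above `ℓ`;
* `McCallum1991_prop_3_1_kernel_of_chebotarev` — packaged with `IsKolyvaginPrime N W K p ℓ`, in
  the shape of the hypothesis `hCeb` of `KolyvaginDescent.HypothesesM.sum_expo_le_M₀_of_casselsTate`
  through the dictionary of `KolyvaginDescent.exists_hypothesesM_of_leavesM`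
  (`A ℓ = ⨅_{v ∋ ℓ} ker loc_v`).

## The proof

Steps A, A′ and C–F are those of `exists_kolyvaginPrime_gt_pow` verbatim (complex conjugation
and its lift, the image of `Γ_K` on `E_p`, the eigenvectors `e_± ∈ E_{p^M}` of order `p^M`, the
finite exceptional set, a Frobenius in `c₀ · res(ρ𝒩)` by Čebotarev, inertness). Step B is
replaced by: `G = ⟨g₁, g₂, T⟩` is a finite `c_*`-stable subgroup with `G = ⟨T⟩ + ℤg₁ + ℤg₂`, so
the pure algebra `Literature.GroupTheory.FiniteAbelian.exists_addMonoidHom_ker_eq_of_involution`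
gives a character `φ : G → E_{p^M}` with `ker φ = ⟨T⟩`, `φ(G^±) ⊆ ℤe_±`; an independent generating
family of eigenclasses `x_i` of `G` (`exists_eigen_indep_generators`) and McCallum's (2)
(`exists_h1Eval_eq_of_indep`) give `ρ ∈ Γ_{K(E_{p^M})}` with `[x_i, ρ] = φ(x_i)`, whence
`[g, ρ^τρ m-twisted] = 2φ(g)` for every `g ∈ G` and `m ∈ 𝒩`; Step G's local criterion then reads
`g_λ = 0 ⟺ φ(g) = 0 ⟺ g ∈ ⟨T⟩`.

No named fact is introduced; the inputs are the Čebotarev density theorem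
(`Automorphic.chebotarev_artinRep`) and the Weil pairing (`exists_weilPairing`), as for Cor. 3.2.

## References

* W. G. McCallum, *Kolyvagin's work on Shafarevich–Tate groups*, in *`L`-functions and
  arithmetic (Durham, 1989)*, LMS Lecture Note Ser. 153, CUP (1991), 295–316: §3 Prop. 3.1,
  (2), (3), Cor. 3.2 (PDF pp. 279–280). [McCallumLMS1991]
* B. H. Gross, *Kolyvagin's work on modular elliptic curves*, same volume, §9. [GrossLMS1991]
* J. Tate, *Global class field theory*, in Cassels–Fröhlich (1967), §2.4. [TateGCFT1967]
-/

noncomputable section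

open scoped Classical Pointwise
open WeierstrassCurve NumberField IsDedekindDomain Field
open Literature.NumberTheory.GaloisRepresentations
open Literature.GroupTheory.FiniteAbelian

universe u

namespace Literature.NumberTheory.EllipticCurves

section Main

variable {W : WeierstrassCurve ℚ} {K : Type u} [Field K] [NumberField K]

/-- **McCallum 1991, Prop. 3.1 (kernel form) — one Kolyvagin prime of level `p^M` above any
bound with prescribed kernel of localisation.** Hypotheses: `K` imaginary quadratic with complex
conjugation `c` (`c² = 1`); `p` odd with `ρ̄_{E,p}` onto and a Weil pairing on `E[p]`; `M ≥ 1`;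
eigenclasses `g₁ ∈ H¹(K, E[p^M])^{ν}`, `g₂ ∈ H¹(K, E[p^M])^{-ν}` and a finite set `T` of
eigenclasses; the Čebotarev density theorem. Conclusion: for every `b` a prime `ℓ > b`,
`ℓ ∤ N d_K`, `ℓ ≠ p`, `(ℓ)` prime in `𝓞 K`, `Frob(ℓ) = Frob(∞)` in `Gal(K(E_{p^M})/ℚ)`, and at the
place `λ ∋ ℓ`: **`g_λ = 0 ⟺ g ∈ ⟨T⟩` for every `g ∈ ⟨g₁, g₂, T⟩`** (McCallum's (3) for the
character `⟨g₁, g₂, T⟩ → ⟨g₁, g₂, T⟩/⟨T⟩ ↪ E_{p^M}^+ ⊕ E_{p^M}^-`).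
[cite: McCallumLMS1991, §3 Prop. 3.1 with (2), (3)] -/
theorem exists_kolyvaginPrime_gt_pow_kernel (hC : Automorphic.chebotarev_artinRep) {N : ℕ}
    [NeZero N] [W.IsElliptic] (hK : IsImaginaryQuadratic K) {p : ℕ} (hp : p.Prime) (hp2 : p ≠ 2)
    (hρ : W.HasSurjectiveModNGaloisRep p) (hW : W.exists_weilPairing p) {M : ℕ} (hM : 1 ≤ M)
    {c : K ≃ₐ[ℚ] K} (hc : c ≠ 1) (hcc : c * c = 1)
    (Tc : Finset (galH1Torsion (W.baseChange K) ((p ^ M : ℕ) : ℤ)))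
    (g₁ g₂ : galH1Torsion (W.baseChange K) ((p ^ M : ℕ) : ℤ)) {ν : ℤ} (hν : ν = 1 ∨ ν = -1)
    (hg₁ : conjAct W c ((p ^ M : ℕ) : ℤ) g₁ = ν • g₁)
    (hg₂ : conjAct W c ((p ^ M : ℕ) : ℤ) g₂ = (-ν) • g₂)
    (hTc : ∀ t ∈ Tc, ∃ e : ℤ, (e = 1 ∨ e = -1) ∧ conjAct W c ((p ^ M : ℕ) : ℤ) t = e • t)
    (b : ℕ) :
    ∃ ℓ : ℕ, b < ℓ ∧ ℓ.Prime ∧ ¬ ℓ ∣ N ∧ ¬ ((ℓ : ℤ) ∣ NumberField.discr K) ∧ ℓ ≠ p ∧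
      (Ideal.span {(ℓ : 𝓞 K)}).IsPrime ∧ FrobEqFrobInfty W K (p ^ M) ℓ ∧
      ∀ g ∈ AddSubgroup.closure (insert g₁ (insert g₂ (Tc : Set _))),
        ∀ v : HeightOneSpectrum (𝓞 K), (ℓ : 𝓞 K) ∈ v.asIdeal →
          (g ∈ (W.baseChange K).torsionLocalKer (v.adicCompletion K) ((p ^ M : ℕ) : ℤ) ↔
            g ∈ AddSubgroup.closure (Tc : Set _)) := by
  classical
  haveI : Fact p.Prime := ⟨hp⟩
  haveI : Algebra.IsQuadraticExtension ℚ K := ⟨hK.1⟩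
  haveI : IsTotallyComplex K := hK.2
  have hp0 : (p : ℤ) ≠ 0 := by exact_mod_cast hp.ne_zero
  have hn0 : ((p ^ M : ℕ) : ℤ) ≠ 0 := by exact_mod_cast pow_ne_zero M hp.ne_zero
  have hpn : (p : ℤ) ∣ ((p ^ M : ℕ) : ℤ) := by
    rw [Nat.cast_pow]; exact dvd_pow_self _ (by omega)
  have hodd : Odd p := hp.odd_of_ne_two hp2
  -- ### Step A: complex conjugation, the involutive lift, the image of `Γ_K` on `E_p`
  obtain ⟨c₀, hc₀⟩ := exists_isComplexConjugation (Rat.castHom ℝ)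
  set t : AlgebraicClosure K ≃+* AlgebraicClosure K :=
    (absGaloisTransport (K := ℚ) (L := K) c₀).toRingEquiv with ht_def
  have ht : IsLiftOfAut c t :=
    RatClosure.isLiftOfAut_absGaloisTransport_of_isImaginaryQuadratic hK hc hc₀
  have hinv : ∀ x, t (t x) = x := fun x ↦
    RatClosure.absGaloisTransport_absGaloisTransport_of_sq_eq_one hc₀.sq_eq_one x
  have hT : ∀ P : geomTorsion (W.baseChange K) p, p • P = 0 := fun P ↦ by
    have := (mem_geomTorsion_iff (W.baseChange K) p _).mp P.2
    apply Subtype.ext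
    rw [AddSubgroupClass.coe_nsmul, ← natCast_zsmul]
    exact this
  have hcard : Nat.card (geomTorsion (W.baseChange K) p) = p ^ 2 :=
    card_torsionPoints_eq_sq_holds (W.baseChange K) (AlgebraicClosure K)
      (by exact_mod_cast hp.ne_zero)
  obtain ⟨eT⟩ := KolyvaginImage.nonempty_addEquiv_of_card_eq_sq hT hcard
  have hsq := RatClosure.exists_smul_eq_of_sq (K := K) W hK.1 (n := p) hρ
  obtain ⟨z, hz⟩ := KolyvaginImage.exists_smul_eq_neg eT hsq
  have hS := KolyvaginImage.eq_bot_or_eq_top eT hsq hp2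
  have hCe := KolyvaginImage.exists_eq_zsmul eT hsq hp2
  -- eigenvectors of `τ` on `E(K̄)[p]`, transported from `E(ℚ̄)[p]`
  obtain ⟨⟨vPlus, hvPlus0, hvPlus⟩, ⟨vMinus, hvMinus0, hvMinus⟩⟩ :=
    RatClosure.exists_eigenvectors W hc₀ hW hp2
  set θ := RatClosure.torsionEquiv (K := K) W p with hθ
  have hePlus : ht.torsionMap W p (θ vPlus) = θ vPlus := by
    rw [← RatClosure.torsionEquiv_smul_of_lift W ht c₀ (fun _ ↦ rfl) p vPlus, hvPlus]
  have heMinus : ht.torsionMap W p (θ vMinus) = -θ vMinus := by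
    rw [← RatClosure.torsionEquiv_smul_of_lift W ht c₀ (fun _ ↦ rfl) p vMinus, hvMinus, map_neg]
  have hPlus0 : θ vPlus ≠ 0 := fun h ↦ hvPlus0 (θ.injective (by rw [h, map_zero]))
  have hMinus0 : θ vMinus ≠ 0 := fun h ↦ hvMinus0 (θ.injective (by rw [h, map_zero]))
  -- ### Step A': the level-`p^M` inputs
  have hz' : ∀ P : geomTorsion (W.baseChange K) ((p ^ M : ℕ) : ℤ), z ^ p ^ (M - 1) • P = -P :=
    smul_eq_neg_geomTorsion_pow (W.baseChange K) hodd hM hz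
  obtain ⟨u, hu⟩ := exists_two_mul_zsmul_eq_of_odd (W.baseChange K) (n := p ^ M) hodd.pow
  obtain ⟨ePlus, hePlus', hPlus0'⟩ := ht.exists_eigenvector_pow W hinv hp hp2 hM (ν := 1)
    (Or.inl rfl) (e₁ := θ vPlus) (by rw [one_smul]; exact hePlus) hPlus0
  obtain ⟨eMinus, heMinus', hMinus0'⟩ := ht.exists_eigenvector_pow W hinv hp hp2 hM (ν := -1)
    (Or.inr rfl) (e₁ := θ vMinus) (by rw [neg_one_zsmul]; exact heMinus) hMinus0
  rw [one_smul] at hePlus'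
  rw [neg_one_zsmul] at heMinus'
  have hkill : ∀ P : geomTorsion (W.baseChange K) ((p ^ M : ℕ) : ℤ), ((p : ℤ) ^ M) • P = 0 :=
    fun P ↦ by
    apply Subtype.ext
    rw [AddSubgroupClass.coe_zsmul, ZeroMemClass.coe_zero]
    have := (mem_geomTorsion_iff (W.baseChange K) _ (P : geomPoints (W.baseChange K))).mp P.2
    exact_mod_cast this
  -- ### Step B″: the subgroup `G = ⟨g₁, g₂, T⟩`, the character `φ`, an eigenbasis, and `ρ`
  let Gs : AddSubgroup (galH1Torsion (W.baseChange K) ((p ^ M : ℕ) : ℤ)) :=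
    AddSubgroup.closure (insert g₁ (insert g₂ (Tc : Set _)))
  let Ks : AddSubgroup (galH1Torsion (W.baseChange K) ((p ^ M : ℕ) : ℤ)) :=
    AddSubgroup.closure (Tc : Set _)
  have hKG : Ks ≤ Gs :=
    AddSubgroup.closure_mono ((Set.subset_insert _ _).trans (Set.subset_insert _ _))
  have hg₁G : g₁ ∈ Gs := AddSubgroup.subset_closure (Set.mem_insert _ _)
  have hg₂G : g₂ ∈ Gs := AddSubgroup.subset_closure (Set.mem_insert_of_mem _ (Set.mem_insert _ _))
  -- `c_*` preserves `Ks` and `Gs` (their generators are eigenclasses)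
  have hstab : ∀ (S : Set (galH1Torsion (W.baseChange K) ((p ^ M : ℕ) : ℤ))),
      (∀ s ∈ S, ∃ e : ℤ, conjAct W c _ s = e • s) →
      ∀ x ∈ AddSubgroup.closure S, conjAct W c ((p ^ M : ℕ) : ℤ) x ∈ AddSubgroup.closure S := by
    intro S hS x hx
    induction hx using AddSubgroup.closure_induction with
    | mem y hy =>
      obtain ⟨e, he⟩ := hS y hy
      rw [he]
      exact AddSubgroup.zsmul_mem _ (AddSubgroup.subset_closure hy) _
    | zero => rw [map_zero]; exact zero_mem _
    | add a b _ _ ha hb => rw [map_add]; exact add_mem ha hb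
    | neg a _ ha => rw [map_neg]; exact neg_mem ha
  have hstabK : ∀ x ∈ Ks, conjAct W c ((p ^ M : ℕ) : ℤ) x ∈ Ks :=
    hstab _ fun s hs ↦ by obtain ⟨e, -, he⟩ := hTc s hs; exact ⟨e, he⟩
  have hstabG : ∀ x ∈ Gs, conjAct W c ((p ^ M : ℕ) : ℤ) x ∈ Gs := by
    refine hstab _ fun s hs ↦ ?_
    rcases hs with rfl | rfl | hs
    · exact ⟨ν, hg₁⟩
    · exact ⟨-ν, hg₂⟩
    · obtain ⟨e, -, he⟩ := hTc s hs; exact ⟨e, he⟩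
  -- `G = ⟨T⟩ + ℤg₁ + ℤg₂`
  have hdec : ∀ x ∈ Gs, ∃ k ∈ Ks, ∃ a₁ a₂ : ℤ, x = k + a₁ • g₁ + a₂ • g₂ := by
    intro x hx
    have hx' : x ∈ AddSubgroup.closure ({g₁} ∪ ({g₂} ∪ (Tc : Set _))) := by
      rwa [← Set.insert_eq, ← Set.insert_eq]
    rw [AddSubgroup.closure_union, AddSubgroup.closure_union, AddSubgroup.mem_sup] at hx'
    obtain ⟨y, hy, z, hz, rfl⟩ := hx'
    rw [AddSubgroup.mem_sup] at hz
    obtain ⟨y', hy', k, hk, rfl⟩ := hz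
    rw [AddSubgroup.mem_closure_singleton] at hy hy'
    obtain ⟨a₁, rfl⟩ := hy
    obtain ⟨a₂, rfl⟩ := hy'
    exact ⟨k, hk, a₁, a₂, by abel⟩
  -- `2` and `p^M` on `H¹(K, E[p^M])`
  have hVM : ∀ x : galH1Torsion (W.baseChange K) ((p ^ M : ℕ) : ℤ), ((p : ℤ) ^ M) • x = 0 :=
    fun x ↦ by
    rw [← Nat.cast_pow]
    exact zsmul_galH1Torsion_eq_zero (W.baseChange K) ((p ^ M : ℕ) : ℤ) x
  obtain ⟨u', hu'⟩ : ∃ u' : ℤ, ∀ x : galH1Torsion (W.baseChange K) ((p ^ M : ℕ) : ℤ),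
      (2 * u') • x = x := by
    obtain ⟨k, hk⟩ : Odd (p ^ M) := hodd.pow
    refine ⟨-(k : ℤ), fun x ↦ ?_⟩
    have hk' : ((p : ℤ) ^ M) = 2 * (k : ℤ) + 1 := by exact_mod_cast hk
    have h1 : (2 * -(k : ℤ)) = 1 - (p : ℤ) ^ M := by linear_combination hk'
    rw [h1, sub_zsmul, one_zsmul, hVM, neg_zero, add_zero]
  -- the subgroup `G` as a group with involution, and `⟨T⟩` inside it
  let τG : Gs →+ Gs := ((conjAct W c ((p ^ M : ℕ) : ℤ)).comp Gs.subtype).codRestrict Gs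
    fun x ↦ hstabG x x.2
  have hτG : ∀ x : Gs, (τG x : galH1Torsion (W.baseChange K) ((p ^ M : ℕ) : ℤ)) =
      conjAct W c _ x := fun _ ↦ rfl
  have hτGinv : ∀ x, τG (τG x) = x := fun x ↦ Subtype.ext (by
    change conjAct W c _ (conjAct W c _ (x : galH1Torsion (W.baseChange K) ((p ^ M : ℕ) : ℤ))) = x
    exact conjAct_conjAct_of_mul_self W hcc _ _)
  have huG : ∀ x : Gs, (2 * u') • x = x := fun x ↦ Subtype.ext (by
    rw [AddSubgroupClass.coe_zsmul]; exact hu' x)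
  have hGM : ∀ x : Gs, ((p : ℤ) ^ M) • x = 0 := fun x ↦ Subtype.ext (by
    rw [AddSubgroupClass.coe_zsmul, ZeroMemClass.coe_zero]; exact hVM x)
  let KsG : AddSubgroup Gs := Ks.addSubgroupOf Gs
  have hKsG : ∀ x ∈ KsG, τG x ∈ KsG := fun x hx ↦ by
    rw [AddSubgroup.mem_addSubgroupOf] at hx ⊢
    exact hstabK _ hx
  -- generators of signs `+` / `-` (swap `g₁, g₂` if `ν = -1`)
  obtain ⟨gp, gm, hgp, hgm, hgenG⟩ : ∃ gp gm : Gs, τG gp = gp ∧ τG gm = -gm ∧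
      ∀ x : Gs, ∃ k ∈ KsG, ∃ a₁ a₂ : ℤ, x = k + a₁ • gp + a₂ • gm := by
    rcases hν with rfl | rfl
    · refine ⟨⟨g₁, hg₁G⟩, ⟨g₂, hg₂G⟩, Subtype.ext (by rw [hτG, hg₁, one_smul]),
        Subtype.ext (by rw [hτG, hg₂, neg_one_zsmul]; rfl), fun x ↦ ?_⟩
      obtain ⟨k, hk, a₁, a₂, hx⟩ := hdec x x.2
      exact ⟨⟨k, hKG hk⟩, (AddSubgroup.mem_addSubgroupOf).mpr hk, a₁, a₂, Subtype.ext (by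
        simpa only [AddSubgroup.coe_add, AddSubgroupClass.coe_zsmul] using hx)⟩
    · refine ⟨⟨g₂, hg₂G⟩, ⟨g₁, hg₁G⟩, Subtype.ext (by rw [hτG, hg₂, neg_neg, one_smul]),
        Subtype.ext (by rw [hτG, hg₁, neg_one_zsmul]; rfl), fun x ↦ ?_⟩
      obtain ⟨k, hk, a₁, a₂, hx⟩ := hdec x x.2
      exact ⟨⟨k, hKG hk⟩, (AddSubgroup.mem_addSubgroupOf).mpr hk, a₂, a₁, Subtype.ext (by
        simp only [AddSubgroup.coe_add, AddSubgroupClass.coe_zsmul]; rw [hx]; abel)⟩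
  -- independence of the eigenlines `ℤe₊`, `ℤe₋`
  have hind_e : ∀ a₁ a₂ : ℤ, a₁ • ePlus + a₂ • eMinus = 0 → a₁ • ePlus = 0 ∧ a₂ • eMinus = 0 := by
    intro a₁ a₂ h
    have h' : a₁ • ePlus - a₂ • eMinus = 0 := by
      have := congrArg (ht.torsionMap W _) h
      rwa [map_add, map_zsmul, map_zsmul, hePlus', heMinus', smul_neg, map_zero,
        ← sub_eq_add_neg] at this
    have h2 : (2 : ℤ) • (a₁ • ePlus) = 0 := by
      rw [two_zsmul]
      linear_combination (norm := module) h + h'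
    have ha : a₁ • ePlus = 0 := by
      rw [← hu (a₁ • ePlus), mul_comm, mul_zsmul, h2, zsmul_zero]
    refine ⟨ha, ?_⟩
    rwa [ha, zero_add] at h
  -- the character `φ : G → E[p^M]` with kernel `⟨T⟩`
  obtain ⟨φ, hφker, hφp, hφm⟩ := exists_addMonoidHom_ker_eq_of_involution hp hGM τG huG KsG
    hKsG gp gm hgp hgm hgenG ePlus eMinus (hkill ePlus) hPlus0' (hkill eMinus) hMinus0' hind_e
  -- `G` is finite (finitely generated and killed by `p^M`)
  haveI : AddGroup.FG Gs := (AddGroup.fg_iff_addSubgroup_fg Gs).mpr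
    ⟨insert g₁ (insert g₂ Tc), by rw [Finset.coe_insert, Finset.coe_insert]⟩
  haveI : Finite Gs := AddCommGroup.finite_of_fg_torsion Gs fun x ↦
    (isOfFinAddOrder_iff_nsmul_eq_zero).mpr ⟨p ^ M, pow_pos hp.pos M, by
      rw [← natCast_zsmul]; exact_mod_cast hGM x⟩
  -- an independent generating family of eigenclasses of `G`
  obtain ⟨ι, _, xs, νs, hνs, hxsτ, hxsind, hxsgen⟩ := exists_eigen_indep_generators τG hτGinv huG
  let cs : ι → galH1Torsion (W.baseChange K) ((p ^ M : ℕ) : ℤ) := fun i ↦ (xs i : _)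
  have hcsτ : ∀ i, conjAct W c ((p ^ M : ℕ) : ℤ) (cs i) = νs i • cs i := fun i ↦ by
    have := congrArg Subtype.val (hxsτ i)
    simpa only [hτG, AddSubgroupClass.coe_zsmul] using this
  -- orders `p^{e_i}` and independence in McCallum's divisibility form
  have hexo : ∀ i, ∃ e : ℕ, e ≤ M ∧ addOrderOf (xs i) = p ^ e := fun i ↦
    (Nat.dvd_prime_pow hp).mp (addOrderOf_dvd_of_nsmul_eq_zero (by
      rw [← natCast_zsmul]; exact_mod_cast hGM (xs i)))
  choose ex hexM hex using hexo
  have he : ∀ i, ((p : ℤ) ^ ex i) • cs i = 0 := fun i ↦ by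
    have := addOrderOf_nsmul_eq_zero (xs i)
    rw [hex i, ← natCast_zsmul] at this
    have := congrArg Subtype.val this
    simpa only [AddSubgroupClass.coe_zsmul, ZeroMemClass.coe_zero, Nat.cast_pow] using this
  have hind : ∀ a : ι → ℤ, ∑ i, a i • cs i = 0 → ∀ i, ((p : ℤ) ^ ex i) ∣ a i := by
    intro a ha i
    have ha' : ∑ i, a i • xs i = 0 := Subtype.ext (by
      simpa only [AddSubgroup.val_finsetSum, AddSubgroupClass.coe_zsmul, ZeroMemClass.coe_zero]
        using ha)
    have := hxsind a ha' i
    rwa [hex i, Nat.cast_pow] at this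
  -- McCallum (2): `ρ` with `[x_i, ρ] = φ(x_i)`
  obtain ⟨ρ, hρT, hρe⟩ := exists_h1Eval_eq_of_indep (W.baseChange K) hp hpn hS hCe hz' hu cs ex
    he hind (fun i ↦ φ (xs i)) fun i ↦ by
      rw [← map_zsmul, show ((p : ℤ) ^ ex i) • xs i = 0 from Subtype.ext (by
        rw [AddSubgroupClass.coe_zsmul, ZeroMemClass.coe_zero]; exact he i), map_zero]
  -- `[g, (ρm)^τ (ρm)] = 2 φ(g)` for `g ∈ G`, `m ∈ 𝒩`
  have hval : ∀ m ∈ evalKer (W.baseChange K) ((p ^ M : ℕ) : ℤ) cs, ∀ x : Gs,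
      h1Eval (W.baseChange K) ((p ^ M : ℕ) : ℤ) (x : galH1Torsion (W.baseChange K) _)
        (ht.conjGalCMH (ρ * m) * (ρ * m)) = (2 : ℤ) • φ x := by
    intro m hm x
    have hρm : ρ * m ∈ torsionFixing (W.baseChange K) ((p ^ M : ℕ) : ℤ) := mul_mem hρT hm.1
    have hF : ht.conjGalCMH (ρ * m) * (ρ * m) ∈ torsionFixing (W.baseChange K) ((p ^ M : ℕ) : ℤ) :=
      mul_mem (ht.conjGalCMH_mem_torsionFixing W hinv _ hρm) hρm
    have hterm : ∀ i, h1Eval (W.baseChange K) ((p ^ M : ℕ) : ℤ) (cs i)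
        (ht.conjGalCMH (ρ * m) * (ρ * m)) = (2 : ℤ) • φ (xs i) := by
      intro i
      rw [h1Eval_mul _ _ _ (ht.conjGalCMH_mem_torsionFixing W hinv _ hρm),
        ht.h1Eval_conjGalCMH_of_eigen W hinv _ (hνs i) (hcsτ i) hρm, h1Eval_mul _ _ _ hρT, hρe i,
        hm.2 i, add_zero]
      rcases hνs i with h1 | h1
      · obtain ⟨k, hk⟩ := AddSubgroup.mem_zmultiples_iff.mp
          (hφp (xs i) (by have := hxsτ i; rwa [h1, one_smul] at this))
        rw [← hk, map_zsmul, hePlus', h1, one_smul, two_zsmul]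
      · obtain ⟨k, hk⟩ := AddSubgroup.mem_zmultiples_iff.mp
          (hφm (xs i) (by have := hxsτ i; rwa [h1, neg_one_zsmul] at this))
        rw [← hk, map_zsmul, heMinus', h1, smul_neg, neg_one_zsmul, neg_neg, two_zsmul]
    obtain ⟨a, hx⟩ := hxsgen x
    have hxV : (x : galH1Torsion (W.baseChange K) _) = ∑ i, a i • cs i := by
      simpa only [AddSubgroup.val_finsetSum, AddSubgroupClass.coe_zsmul] using
        congrArg Subtype.val hx
    rw [hxV, h1Eval_sum _ _ _ _ hF]
    simp_rw [h1Eval_zsmul _ _ _ _ hF, hterm]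
    conv_rhs => rw [hx, map_sum, Finset.smul_sum]
    refine Finset.sum_congr rfl fun i _ ↦ ?_
    rw [map_zsmul, smul_comm]
  have hkerG : ∀ m ∈ evalKer (W.baseChange K) ((p ^ M : ℕ) : ℤ) cs, ∀ x : Gs,
      h1Eval (W.baseChange K) ((p ^ M : ℕ) : ℤ) (x : galH1Torsion (W.baseChange K) _)
        (ht.conjGalCMH (ρ * m) * (ρ * m)) = 0 ↔
        (x : galH1Torsion (W.baseChange K) _) ∈ Ks := by
    intro m hm x
    rw [hval m hm x, ← AddSubgroup.mem_addSubgroupOf, ← hφker x]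
    constructor
    · intro h
      rw [← hu (φ x), mul_comm, mul_zsmul, h, zsmul_zero]
    · intro h
      rw [h, zsmul_zero]
  -- ### Steps C–H: the Čebotarev step (`HeegnerPointsKolyvaginPrimaryCebotarevFrobeniusProofs`)
  obtain ⟨ℓ, hbℓ, hℓ, hℓN, hℓD, hℓp, hprime, hfrob, m, hm, hloc⟩ :=
    exists_kolyvaginPrime_gt_of_galoisElement (N := N) hC hK hp hc₀ ht hinv cs hρT b
  refine ⟨ℓ, hbℓ, hℓ, hℓN, hℓD, hℓp, hprime, hfrob, fun g hg v hv ↦ ?_⟩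
  have hspan : g ∈ AddSubgroup.closure (Set.range cs) := by
    obtain ⟨a, hx⟩ := hxsgen ⟨g, hg⟩
    have hgV : g = ∑ i, a i • cs i := by
      simpa only [AddSubgroup.val_finsetSum, AddSubgroupClass.coe_zsmul] using
        congrArg Subtype.val hx
    rw [hgV]
    exact AddSubgroup.sum_mem _ fun i _ ↦
      AddSubgroup.zsmul_mem _ (AddSubgroup.subset_closure (Set.mem_range_self i)) _
  exact (hloc g hspan v hv).trans (hkerG m hm ⟨g, hg⟩)


/-- **McCallum 1991, Prop. 3.1 in kernel form, for Kolyvagin primes `ℓ ∈ S₁(M)` of `E/ℚ` and `K`.**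
The conclusion of `exists_kolyvaginPrime_gt_pow_kernel` packaged with `IsKolyvaginPrime N W K p ℓ`
(`ℓ ∤ N d_K p`, `(ℓ)` prime, `Frob(ℓ) = Frob(∞)` on `E[p]`) and `FrobEqFrobInfty W K (p^M) ℓ`, i.e.
in the shape of the hypothesis `hCeb` of
`KolyvaginDescent.HypothesesM.sum_expo_le_M₀_of_casselsTate` through the dictionary of
`KolyvaginDescent.exists_hypothesesM_of_leavesM` (`Kol ℓ = IsKolyvaginPrime ∧ FrobEqFrobInfty`,
`A ℓ = ⨅_{v ∋ ℓ} ker loc_v`, `τ = c_*`). [cite: McCallumLMS1991, §3 Prop. 3.1 with (2), (3)] -/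
theorem McCallum1991_prop_3_1_kernel_of_chebotarev (hC : Automorphic.chebotarev_artinRep) {N : ℕ}
    [NeZero N] [W.IsElliptic] (hK : IsImaginaryQuadratic K) {p : ℕ} (hp : p.Prime) (hp2 : p ≠ 2)
    (hρ : W.HasSurjectiveModNGaloisRep p) (hW : W.exists_weilPairing p) {M : ℕ} (hM : 1 ≤ M)
    {c : K ≃ₐ[ℚ] K} (hc : c ≠ 1) (hcc : c * c = 1)
    (Tc : Finset (galH1Torsion (W.baseChange K) ((p ^ M : ℕ) : ℤ)))
    (g₁ g₂ : galH1Torsion (W.baseChange K) ((p ^ M : ℕ) : ℤ)) {ν : ℤ} (hν : ν = 1 ∨ ν = -1)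
    (hg₁ : conjAct W c ((p ^ M : ℕ) : ℤ) g₁ = ν • g₁)
    (hg₂ : conjAct W c ((p ^ M : ℕ) : ℤ) g₂ = (-ν) • g₂)
    (hTc : ∀ t ∈ Tc, ∃ e : ℤ, (e = 1 ∨ e = -1) ∧ conjAct W c ((p ^ M : ℕ) : ℤ) t = e • t)
    (b : ℕ) :
    ∃ ℓ : ℕ, b < ℓ ∧ IsKolyvaginPrime N W K p ℓ ∧ FrobEqFrobInfty W K (p ^ M) ℓ ∧
      ∀ g ∈ AddSubgroup.closure (insert g₁ (insert g₂ (Tc : Set _))),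
        ∀ v : HeightOneSpectrum (𝓞 K), (ℓ : 𝓞 K) ∈ v.asIdeal →
          (g ∈ (W.baseChange K).torsionLocalKer (v.adicCompletion K) ((p ^ M : ℕ) : ℤ) ↔
            g ∈ AddSubgroup.closure (Tc : Set _)) := by
  obtain ⟨ℓ, hbℓ, hℓ, hℓN, hℓD, hℓp, hprime, hfrob, hloc⟩ := exists_kolyvaginPrime_gt_pow_kernel
    (N := N) hC hK hp hp2 hρ hW hM hc hcc Tc g₁ g₂ hν hg₁ hg₂ hTc b
  exact ⟨ℓ, hbℓ, ⟨hℓ, hℓN, hℓD, hℓp, hprime, hfrob.of_dvd (dvd_pow_self p (by omega))⟩, hfrob, hloc⟩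

end Main

end Literature.NumberTheory.EllipticCurves

end
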